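import Summits.NavierStokesRegularity.NavierStokesRegularity.Theorems.ScenarioCensusRowF1FrozenThird
import Summits.NavierStokesRegularity.NavierStokesRegularity.Theorems.ScenarioCensusRowF1InviscidTop
import Literature.Analysis.FunctionSpaces.WeakTimeDerivativeClassical
import HarnessLib

/-!
# LINE «frozen-top» port, part 3/6: §4 THE KILL (a) — the weak time-rigidity chain re-proved: cross-product tests, `pairing_eq_of_weakEquilibrium`

Re-homed for the scenario census (typer seat ns-census-typer-1 g8; the cells F1fzq ⊇ F1fz are MEMBERS OF RECORD «DECIDED IN KERNEL IN FILES» of row F1 since census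
v1.72 (critic idea-crit-3 g7 PASS — no price 23:50:38Z; ref ns-census-ref g9 PRE-CHECK ✓ §14.21 item 32 (shim probe a49fdeaa); lead-presearch label); this port makes
them TREE-decided): VERBATIM PORT of ns-idea-3 LINE 20 «frozen-top», `pub/ideators/ns-idea-3/lines/frozen-top/line-frozen-top.lean` sha16 edc3c151346cc4e4 (1610 l.,
0 sorry; the critic's / ref's farm runs went through a shim because the line's import `Literature.Analysis.FunctionSpaces.WeakTimeDerivativeClassical` had no
farm build — in this port that import is carried only by the part that uses it, `…FrozenPairing` (`FunctionSpaces.sub_eq_intervalIntegral_of_forall_test` in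
`pairing_eq_of_weakEquilibrium`)), split for the 400-line rule into `ScenarioCensusRowF1Frozen` (§1–§2 with the `C²_loc`
tool) → `…FrozenThird` (`C³_loc`) → `…FrozenPairing` (§4a) → `…FrozenKill` (§4b) → `…FrozenTransfer` (§5–§6) → `…FrozenTop` (§7 + census KEYS).  Lean text VERBATIM in namespace `…Theorems.ScenarioCensus.FrozenTop` (the line's `…Cruxes.ScenarioCensusRowF1.FrozenTopLine`
re-homed); port edits: the WTDC import moved to the one part that needs it, `@[conjecture]` on the residual `FreezeSlack` (≡ `ScenarioCensus.Row_F1`, OPEN), five one-line docstrings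
added (gate lint).

No census VALUE is moved here (row F1 stays OPEN-WITH-LINE; the members become TREE-decided by name); NS regularity is NOT proved; `Row_F1` is untouched
(zero movement, `freezeSlack_iff_rowF1`); no summit statement is proved by this file. Lemmas that restate already-landed tree declarations are taken BY NAME (gate lint `dedup.landed`): `fderiv_smul_stPull_apply` = `InviscidTop.fderiv_smul_stPull_apply`, `fderiv_smul_stPull` = `InviscidTop.fderiv_smul_stPull`, `fderiv_fderiv_smul_stPull` = `InviscidTop.fderiv_fderiv_smul_stPull`, `fderiv_fderiv_zoom` = `InviscidTop.fderiv_fderiv_zoom`, `tendsto_clm_of_tendsto_apply` = `InviscidTop.tendsto_clm_of_tendsto_apply`, `tendsto_fderiv_fderiv_apply_of_bound` = `InviscidTop.tendsto_fderiv_fderiv_apply_of_bound`, `tendsto_fderiv_fderiv_of_bound` = `InviscidTop.tendsto_fderiv_fderiv_of_bound`, `tendsto_fderiv_fderiv_of_typeI_seq_Ioo` = `InviscidTop.tendsto_fderiv_fderiv_of_typeI_seq_Ioo`, `tendsto_fderiv_fderiv_of_isTypeIAncientMild_seq` = `InviscidTop.tendsto_fderiv_fderiv_of_isTypeIAncientMild_seq`,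 `sing_of_not_bounded` = `InviscidTop.sing_of_not_bounded`, `tendsto_physicalTime` = `ColumnarTop.tendsto_physicalTime`, `eventually_fast` = `ColumnarTop.eventually_fast`, `sqrt_timeLag` = `StretchedTop.sqrt_timeLag`, `forall_of_forall_ne_zero` = `StretchedTop.forall_of_forall_ne_zero`.
-/

-- the summit and its single problem share the name `NavierStokesRegularity` (D-0017 nested layout)
set_option linter.dupNamespace false

noncomputable section

open MeasureTheory Set Function Filter TopologicalSpace Metric
open scoped Topology NNReal ENNReal InnerProductSpace RealInnerProductSpace Laplacian

namespace Summit.NavierStokesRegularity.NavierStokesRegularity.Theorems.ScenarioCensus.FrozenTop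

open Literature.Analysis Literature.Analysis.FluidPDE
open Summit.NavierStokesRegularity.NavierStokesRegularity.Theorems

/-! ## §4 THE KILL.  (a) LINE 19's weak time-rigidity chain (re-proved verbatim so that the line is self-contained):
weak equilibrium on every slice ⇒ constant increments ⇒ `W ≡ 0`; frozen vorticity ⇒ `W ≡ 0`.
(b) NEW: vorticity-steady slices ⇒ frozen vorticity (the vorticity equation on the classical windows of `𝒦`) ⇒ `W ≡ 0`. -/

/-- The curl-type test field `x ↦ (∂ₐg)(x) c − (∂_c g)(x) a = curl (g · (c × a))` of a scalar test function. -/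
def cp (g : E3 → ℝ) (a c : E3) : E3 → E3 := fun x => fderiv ℝ g x a • c - fderiv ℝ g x c • a

/-- The cross-product test field `cp g a c` is a test function. -/
theorem cp_isTest {g : E3 → ℝ} (hg : FunctionSpaces.IsTestFunctionOn (⊤ : Opens E3) g) (a c : E3) :
    FunctionSpaces.IsTestFunctionOn (⊤ : Opens E3) (cp g a c) :=
  isTestFunctionOn_curlPair hg a c

/-- The cross-product test field `cp g a c` is divergence-free. -/
theorem cp_isDivFree {g : E3 → ℝ} (hg : FunctionSpaces.IsTestFunctionOn (⊤ : Opens E3) g) (a c : E3) :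
    VectorCalculus.IsDivFree (cp g a c) :=
  isDivFree_curlPair_of_contDiff (contDiff_infty.1 hg.contDiff 2) a c

/-- **Step 1 (the weak Navier–Stokes identity, tested with `η(t) · curl-type field`).**  For a `𝒦`-field `u` that is
a KNSS bounded weak solution on `(−∞, 0)` and is in WEAK EULERIAN EQUILIBRIUM on every slice
(`ΔU − (U·∇)U ⊥` curl-type tests), the curl-type pairings `t ↦ ∫⟪u(t), Ψ⟫` are constant in time. -/
theorem pairing_eq_of_weakEquilibrium {C : ℝ} {u : ℝ → E3 → E3} (hu : IsTypeIAncientMild C u)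
    (hweak : IsBoundedWeakNSSolutionOn (Iio (0 : ℝ)) isOpen_Iio 1 u)
    (hbal : ∀ s < (0 : ℝ), ∀ g : E3 → ℝ, FunctionSpaces.IsTestFunctionOn (⊤ : Opens E3) g → ∀ a c : E3,
      ∫ x, ⟪(Δ (u s)) x - convect (u s) (u s) x, cp g a c x⟫ = 0)
    {g : E3 → ℝ} (hg : FunctionSpaces.IsTestFunctionOn (⊤ : Opens E3) g) (a c : E3)
    {s t : ℝ} (hs : s < 0) (ht : t < 0) :
    ∫ x, ⟪u t x, cp g a c x⟫ = ∫ x, ⟪u s x, cp g a c x⟫ := by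
  set Ψ : E3 → E3 := cp g a c with hΨdef
  have hΨ : FunctionSpaces.IsTestFunctionOn (⊤ : Opens E3) Ψ := cp_isTest hg a c
  have hΨdiv : VectorCalculus.IsDivFree Ψ := cp_isDivFree hg a c
  have hΨ1 : ContDiff ℝ 1 Ψ := hΨ.contDiff.of_le (by norm_cast)
  have hΨ2 : ContDiff ℝ 2 Ψ := hΨ.contDiff.of_le (by norm_cast)
  have hΨc : HasCompactSupport Ψ := hΨ.hasCompactSupport
  have hC : 0 ≤ C := hu.nonneg
  -- the pairing `A(τ) = ∫ ⟪u(τ), Ψ⟫`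
  set A : ℝ → ℝ := fun τ => ∫ x, ⟪u τ x, Ψ x⟫ with hAdef
  -- ### continuity of `A` on `(−∞, 0)` (dominated convergence; Type-I bound on a half-window)
  have hAc : ∀ τ₀ < (0 : ℝ), ContinuousAt A τ₀ := by
    intro τ₀ hτ₀
    have hτ₀2 : τ₀ / 2 < 0 := by linarith
    have hwin : Iio (τ₀ / 2) ∈ 𝓝 τ₀ := Iio_mem_nhds (by linarith)
    refine continuousAt_of_dominated (bound := fun x => C / Real.sqrt (-(τ₀ / 2)) * ‖Ψ x‖) ?_ ?_ ?_ ?_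
    · filter_upwards [hwin] with τ hτ
      exact ((hu.continuous_slice (lt_trans hτ hτ₀2)).inner hΨ.contDiff.continuous).aestronglyMeasurable
    · filter_upwards [hwin] with τ (hτ : τ < τ₀ / 2)
      refine Eventually.of_forall fun x => ?_
      have hτ0 : τ < 0 := lt_trans hτ hτ₀2
      calc ‖⟪u τ x, Ψ x⟫‖ ≤ ‖u τ x‖ * ‖Ψ x‖ := norm_inner_le_norm _ _
        _ ≤ C / Real.sqrt (-τ) * ‖Ψ x‖ := mul_le_mul_of_nonneg_right (hu.norm_le hτ0 x) (norm_nonneg _)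
        _ ≤ C / Real.sqrt (-(τ₀ / 2)) * ‖Ψ x‖ := by
          refine mul_le_mul_of_nonneg_right ?_ (norm_nonneg _)
          exact div_le_div_of_nonneg_left hC (Real.sqrt_pos.2 (by linarith))
            (Real.sqrt_le_sqrt (by linarith))
    · exact ((hΨ.contDiff.continuous.norm).integrable_of_hasCompactSupport hΨc.norm).const_mul _
    · refine Eventually.of_forall fun x => ?_
      have h1 : ContinuousAt (fun τ => u τ x) τ₀ := by
        have hc := hu.continuousOn_uncurry
        have hm : (τ₀, x) ∈ Iio (0 : ℝ) ×ˢ (univ : Set E3) := ⟨hτ₀, mem_univ _⟩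
        have hca : ContinuousAt (uncurry u) (τ₀, x) :=
          hc.continuousAt ((isOpen_Iio.prod isOpen_univ).mem_nhds hm)
        exact hca.comp (f := fun τ : ℝ => (τ, x)) (continuous_id.prodMk continuous_const).continuousAt
      exact h1.inner continuousAt_const
  have hAcont : ∀ a₀ : ℝ, ContinuousOn A (Ioo a₀ 0) := fun a₀ =>
    fun τ hτ => (hAc τ hτ.2).continuousWithinAt
  -- ### the spatial integral at a fixed time `τ < 0`
  have hG : ∀ τ < (0 : ℝ), (∫ x, ⟪u τ x, convect (u τ) Ψ x⟫) + ∫ x, ⟪u τ x, (Δ Ψ) x⟫ = 0 := by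
    intro τ hτ
    have hu1 : ContDiff ℝ 1 (u τ) := (hu.contDiff_slice hτ).of_le (by norm_cast)
    have hu2 : ContDiff ℝ 2 (u τ) := (hu.contDiff_slice hτ).of_le (by norm_cast)
    have h1 := integral_inner_convect_add_eq_zero hu1 hu1 hΨ1 hΨc
    have hdiv0 : ∫ x, VectorCalculus.divergence (u τ) x * ⟪u τ x, Ψ x⟫ = 0 := by
      simp [hu.isDivFree hτ _]
    rw [hdiv0, add_zero] at h1
    have h2 := integral_inner_laplacian_comm hu2 hΨ2 hΨc
    have h3 : (∫ x, ⟪(Δ (u τ)) x, Ψ x⟫) - ∫ x, ⟪convect (u τ) (u τ) x, Ψ x⟫ = 0 := by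
      have hIa : Integrable (fun x => ⟪(Δ (u τ)) x, Ψ x⟫) :=
        integrable_inner_of_hasCompactSupport_right (continuous_laplacian hu2) hΨ.contDiff.continuous hΨc
      have hIb : Integrable (fun x => ⟪convect (u τ) (u τ) x, Ψ x⟫) :=
        integrable_inner_of_hasCompactSupport_right ((contDiff_one_iff_fderiv.1 hu1).2.clm_apply
          hu1.continuous) hΨ.contDiff.continuous hΨc
      rw [← integral_sub hIa hIb]
      simpa only [inner_sub_left] using hbal τ hτ g hg a c
    linarith
  -- ### the weak identity with the test field `η(t) Ψ(x)`
  have hkey : ∀ η : ℝ → ℝ, ContDiff ℝ (⊤ : ℕ∞) η → HasCompactSupport η → ∀ a₀ : ℝ, tsupport η ⊆ Ioo a₀ 0 →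
      ∫ τ in Ioo a₀ 0, (deriv η τ * A τ + η τ * (0 : ℝ)) = 0 := by
    intro η hη hηc a₀ hηsupp
    set ψ : ℝ → E3 → E3 := fun τ x => η τ • Ψ x with hψdef
    have htop : IsSpaceTimeTestOn (⊤ : Opens (ℝ × E3)) ψ := isSpaceTimeTestOn_time_smul hη hηc hΨ
    have hslab : IsSpaceTimeTestOn (slab E3 (Iio (0 : ℝ)) isOpen_Iio) ψ := by
      refine ⟨htop.contDiff, htop.hasCompactSupport, fun z hz => ?_⟩
      rw [SetLike.mem_coe, mem_slab]
      have hz1 : z.1 ∈ tsupport η := by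
        by_contra hno
        have hev : ∀ᶠ s in 𝓝 z.1, η s = 0 := notMem_tsupport_iff_eventuallyEq.1 hno
        have hev' : ∀ᶠ w in 𝓝 z, uncurry ψ w = 0 := by
          filter_upwards [continuousAt_fst.eventually hev] with w hw
          simp [hψdef, uncurry, hw]
        exact (notMem_tsupport_iff_eventuallyEq.2 hev') hz
      exact Ioo_subset_Iio_self (hηsupp hz1)
    have hψdiv : ∀ τ, VectorCalculus.IsDivFree (ψ τ) := by
      intro τ x
      have hd : DifferentiableAt ℝ (fun _ : E3 => η τ) x := differentiableAt_const _
      have e : ψ τ = fun y => (fun _ : E3 => η τ) y • Ψ y := rfl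
      rw [e, divergence_smul_apply hd (hΨ1.differentiable one_ne_zero x), hΨdiv x, mul_zero, zero_add]
      have hg0 : gradient (fun _ : E3 => η τ) x = 0 := by
        have h := (hasFDerivAt_const (η τ) x).hasGradientAt
        simp only [map_zero] at h
        exact h.gradient
      rw [hg0, inner_zero_right]
    have hW := hweak.2.2.2 ψ hslab hψdiv
    -- pointwise simplification of the integrand for `τ < 0`
    have hpt : ∀ τ < (0 : ℝ), (∫ x, (⟪u τ x, timeDeriv ψ τ x⟫ + ⟪u τ x, convect (u τ) (ψ τ) x⟫ +
        1 * ⟪u τ x, (Δ (ψ τ)) x⟫)) = deriv η τ * A τ := by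
      intro τ hτ
      have e1 : ∀ x, timeDeriv ψ τ x = deriv η τ • Ψ x := fun x =>
        timeDeriv_time_smul (hη.differentiable (by simp)) Ψ τ x
      have e2 : ∀ x, convect (u τ) (ψ τ) x = η τ • convect (u τ) Ψ x := fun x => by
        simp only [convect, hψdef]
        rw [fderiv_fun_const_smul (hΨ1.differentiable one_ne_zero x)]
        rfl
      have e3 : ∀ x, (Δ (ψ τ)) x = η τ • (Δ Ψ) x := fun x => by
        show (Δ (fun y => η τ • Ψ y)) x = η τ • (Δ Ψ) x
        exact InnerProductSpace.laplacian_smul (η τ) (hΨ2.contDiffAt)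
      have hI1 := integrable_inner_of_hasCompactSupport_right (hu.continuous_slice hτ) hΨ.contDiff.continuous hΨc
      have hI2c : HasCompactSupport (fun x => convect (u τ) Ψ x) := by
        refine (hΨc.fderiv (𝕜 := ℝ)).mono fun x hx => ?_
        contrapose! hx
        rw [Function.notMem_support] at hx ⊢
        simp [convect, hx]
      have hI2 : Integrable (fun x => ⟪u τ x, convect (u τ) Ψ x⟫) :=
        integrable_inner_of_hasCompactSupport_right (hu.continuous_slice hτ)
          (((contDiff_one_iff_fderiv.1 hΨ1).2.clm_apply (hu.continuous_slice hτ))) hI2c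
      have hI3 := integrable_inner_of_hasCompactSupport_right (hu.continuous_slice hτ)
        (continuous_laplacian hΨ2) (hasCompactSupport_laplacian hΨc)
      simp_rw [e1, e2, e3, inner_smul_right, one_mul]
      rw [integral_add (by exact (hI1.const_mul _).add (hI2.const_mul _)) (hI3.const_mul _),
        integral_add (hI1.const_mul _) (hI2.const_mul _), integral_const_mul, integral_const_mul,
        integral_const_mul]
      have := hG τ hτ
      have e4 : deriv η τ * A τ + η τ * (∫ x, ⟪u τ x, convect (u τ) Ψ x⟫) + η τ * ∫ x, ⟪u τ x, (Δ Ψ) x⟫ =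
          deriv η τ * A τ + η τ * ((∫ x, ⟪u τ x, convect (u τ) Ψ x⟫) + ∫ x, ⟪u τ x, (Δ Ψ) x⟫) := by ring
      rw [e4, this, mul_zero, add_zero]
    have hW' : ∫ τ in Iio (0 : ℝ), deriv η τ * A τ = 0 :=
      (setIntegral_congr_fun measurableSet_Iio fun τ hτ => (hpt τ hτ).symm).trans hW
    -- `deriv η` vanishes off `tsupport η ⊆ (a₀, 0)`
    have hvan : ∀ τ, τ ∉ Ioo a₀ 0 → deriv η τ * A τ = 0 := by
      intro τ hτ
      have : deriv η τ = 0 := by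
        have hns : τ ∉ tsupport η := fun h => hτ (hηsupp h)
        exact notMem_support.1 fun h => hns (support_deriv_subset h)
      rw [this, zero_mul]
    have e5 : ∫ τ in Ioo a₀ 0, (deriv η τ * A τ + η τ * (0 : ℝ)) = ∫ τ in Ioo a₀ 0, deriv η τ * A τ :=
      setIntegral_congr_fun measurableSet_Ioo fun τ _ => by ring
    rw [e5, setIntegral_eq_integral_of_forall_compl_eq_zero fun τ hτ => hvan τ hτ,
      ← setIntegral_eq_integral_of_forall_compl_eq_zero (s := Iio (0 : ℝ))
        fun τ hτ => hvan τ fun h => hτ (Ioo_subset_Iio_self h)]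
    exact hW'
  -- ### du Bois-Reymond on the window `(min s t − 1, 0)`
  set a₀ : ℝ := min s t - 1 with ha₀
  have hs' : s ∈ Ioo a₀ 0 := ⟨by rw [ha₀]; linarith [min_le_left s t], hs⟩
  have ht' : t ∈ Ioo a₀ 0 := ⟨by rw [ha₀]; linarith [min_le_right s t], ht⟩
  have key := FunctionSpaces.sub_eq_intervalIntegral_of_forall_test (A := A) (B := fun _ => (0 : ℝ))
    (hAcont a₀) continuousOn_const (fun η hη hηc hηs => hkey η hη hηc a₀ hηs) hs' ht'
  rw [intervalIntegral.integral_zero] at key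
  linarith

end Summit.NavierStokesRegularity.NavierStokesRegularity.Theorems.ScenarioCensus.FrozenTop

end
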